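import Literature.AlgebraicGeometry.Resolution.ArithmeticalThreefolds
import Literature.AlgebraicGeometry.Resolution.RegularLocalRingsProofs
import Mathlib.AlgebraicGeometry.ValuativeCriterion
import Mathlib.AlgebraicGeometry.FunctionField
import Mathlib.AlgebraicGeometry.Morphisms.FiniteType
import HarnessLib

/-!
# Resolution of singularities implies local uniformization

Topic: `Literature/AlgebraicGeometry/Resolution`. The folklore implication behind the wording
"`CossartPiltant2019LU3` is a corollary of Thm. 1.1" in `ArithmeticalThreefolds.lean` (there a
docstring claim, here a proof), and behind route item `LurelOfResolution` (stmt-0739) of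
`Summits/ResolutionOfSingularities/ResolutionOfSingularities/Theses/Valuative.lean`
("`ResolutionInChar p → LUrel_p`", planner: "folklore, Zariski 1940 / Novacoski–Spivakovsky
2014 §1 … by the valuative criterion of properness"):

> if `Spec A` has a proper birational regular model `π : X → Spec A`, then every valuation
> ring `O` of `K = Frac A` containing `A` is uniformized by a finitely generated `A`-algebra
> `A ⊆ T ⊆ O`: the localisation of `T` at `𝔪_O ∩ T` is a regular local ring.

## The proof (`exists_fg_regular_of_hasResolution`)

* `IsResolution π` gives `π` proper, an open dense `U ⊆ Spec A` with `π⁻¹U ≅ U`, and all local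
  rings of `X` regular. The generic point `η = (0)` of `Spec A` lies in `U`, so `Spec K → Spec A`
  lifts to `i₁ : Spec K → π⁻¹U ⊆ X`; with `i₂ : Spec O → Spec A` this is a valuative square,
  and the existence part of the valuative criterion (`UniversallyClosed.eq_valuativeCriterion`,
  Mathlib) yields a lift `l : Spec O → X`.
* The centre `x' = l(𝔪_O)` has a regular local ring `𝒪_{X,x'}`, a domain by Matsumura's
  Thm. 14.3 (`Matsumura1987_14_3_holds`, `RegularLocalRingsProofs.lean`), and `l` induces a local
  homomorphism `ψ : 𝒪_{X,x'} → O` (`Scheme.stalkClosedPointTo`).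
* `ψ` is injective: writing `γ₀` for the generic point of `Spec O` and `ξ = l(γ₀)`, the square
  `𝒪_{X,x'} → 𝒪_{X,ξ} → 𝒪_{Spec O,γ₀}` = `𝒪_{X,x'} → O → 𝒪_{Spec O, γ₀}` commutes;
  `𝒪_{X,x'} → 𝒪_{X,ξ}` is injective because `𝒪_{X,x'}` is a domain
  (`stalkSpecializes_injective_of_isDomain`), and `𝒪_{X,ξ} → 𝒪_{Spec O,γ₀}` is injective because
  `Spec K → Spec O → X` equals `i₁`, which factors through the isomorphism `π⁻¹U ≅ U` and
  `Spec K → Spec A`, whose stalk map issues from the field `𝒪_{Spec A,η}`.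
* An affine neighbourhood `V ∋ x'` has `Γ(X, V)` of finite type over `A` (`π` is locally of
  finite type); `T :=` the image of `Γ(X, V) → 𝒪_{X,x'} → O → K` is a finitely generated
  `A`-subalgebra of `O`, and `𝒪_{X,x'} = Γ(X,V)_𝔮 → T_{𝔪_O ∩ T}` is bijective (`𝔮` = the prime of
  `x'` = preimage of `𝔪_O`; injectivity by injectivity of `ψ`), so `T_{𝔪_O ∩ T}` is regular.

## Consequences (all proved)

* `exists_affineModel_regular_of_hasResolution` — the same over a ground field `k`, for affine
  models `A ⊆ O` of `K/k` (output a finitely generated `k`-subalgebra `A ⊆ A' ⊆ O`).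
* `ResolutionOverUpToDim.localUniformization`, `CossartPiltant2019.lu3 :
  CossartPiltant2019 → CossartPiltant2019LU3` (the named fact `CossartPiltant2019LU3` of
  `ArithmeticalThreefolds.lean` is now a proved corollary of `CossartPiltant2019`).
* `ResolutionInChar.relLocalUniformization : ResolutionInChar p → RelLocalUniformization k K O`
  (all `k` of characteristic `p`, all `K`, `O`), `ResolutionInChar.localUniformizationInChar :
  ResolutionInChar p → LocalUniformizationInChar p`, `Hironaka1964.localUniformizationInChar`
  (Zariski's 1940 local uniformization theorem in characteristic zero, from Hironaka's theorem),
  and `lurel_of_resolutionInChar`, the statement of route item `LurelOfResolution` verbatim.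

## Sources

* O. Zariski, *Local uniformization on algebraic varieties*, Ann. of Math. 41 (1940) 852–896
  (local uniformization in characteristic zero; the converse direction, uniformization ⇒
  resolution in dimension ≤ 3, is Zariski 1944 / Cossart–Piltant).
* J. Novacoski, M. Spivakovsky, *Reduction of local uniformization to the rank one case*,
  EMS Ser. Congr. Rep. (2014), §1 (local uniformization as the local form of resolution).
* V. Cossart, O. Piltant, J. Algebra 529 (2019) 268–535, Thm. 1.1 and §4.1 (LU).
* A. Grothendieck, EGA II 7.3.8 (valuative criterion of properness); Mathlib
  `AlgebraicGeometry.ValuativeCriterion`.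
* H. Matsumura, *Commutative Ring Theory*, Thm. 14.3 (regular local rings are domains).
-/

noncomputable section

open CategoryTheory AlgebraicGeometry TopologicalSpace IsLocalRing

namespace Literature.AlgebraicGeometry.Resolution

universe u

/-! ## Stalk lemmas -/

/-- Transport of `IsField` along an equality of points. [folklore] -/
theorem isField_stalk_of_eq {X : Scheme.{u}} {x y : X} (h : x = y)
    (hx : IsField (X.presheaf.stalk x)) : IsField (X.presheaf.stalk y) := by
  subst h; exact hx

/-- Injectivity of a stalk map is invariant under equality of morphisms. [folklore] -/
theorem stalkMap_injective_congr {X Y : Scheme.{u}} {f g : X ⟶ Y} (e : f = g) (x : X) :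
    Function.Injective (f.stalkMap x) ↔ Function.Injective (g.stalkMap x) := by
  subst e; exact Iff.rfl

/-- `germ ≫ stalkClosedPointTo` is invariant under equality of morphisms. [folklore] -/
theorem germ_stalkClosedPointTo_congr {R : CommRingCat.{u}} [IsLocalRing R] {Y : Scheme.{u}}
    {f g : Spec R ⟶ Y} (e : f = g) (U : Y.Opens) (hU : f (closedPoint R) ∈ U) :
    Y.presheaf.germ U _ hU ≫ Scheme.stalkClosedPointTo f =
      Y.presheaf.germ U _ (e ▸ hU) ≫ Scheme.stalkClosedPointTo g := by
  subst e; rfl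

/-- On any scheme, the specialization map `𝒪_{X,x} → 𝒪_{X,ξ}` (`ξ ⤳ x`) is injective as soon
as `𝒪_{X,x}` is a domain (both are localizations of the coordinate ring of an affine
neighbourhood, at primes `𝔯 ⊆ 𝔮`). [folklore] -/
theorem stalkSpecializes_injective_of_isDomain {X : Scheme.{u}} {ξ x : X} (h : ξ ⤳ x)
    [IsDomain (X.presheaf.stalk x)] :
    Function.Injective (X.presheaf.stalkSpecializes h) := by
  classical
  obtain ⟨_, ⟨V, hV : IsAffineOpen V, rfl⟩, hxV, -⟩ :=
    X.isBasis_affineOpens.exists_subset_of_mem_open (Set.mem_univ x) isOpen_univ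
  have hξV : ξ ∈ V := h.mem_open V.2 hxV
  letI algx := X.presheaf.algebra_section_stalk (⟨x, hxV⟩ : V)
  letI algξ := X.presheaf.algebra_section_stalk (⟨ξ, hξV⟩ : V)
  have hlx := hV.isLocalization_stalk ⟨x, hxV⟩
  have hlξ := hV.isLocalization_stalk ⟨ξ, hξV⟩
  set 𝔮 := (hV.primeIdealOf ⟨x, hxV⟩).asIdeal with h𝔮
  set 𝔯 := (hV.primeIdealOf ⟨ξ, hξV⟩).asIdeal with h𝔯
  -- `𝔯 ≤ 𝔮`
  have hle : 𝔯 ≤ 𝔮 := by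
    rw [h𝔯, h𝔮, PrimeSpectrum.asIdeal_le_asIdeal, PrimeSpectrum.le_iff_specializes]
    have h' : (⟨ξ, hξV⟩ : V) ⤳ ⟨x, hxV⟩ := V.isOpenEmbedding'.isInducing.specializes_iff.mp h
    exact h'.map hV.isoSpec.hom.base.hom.continuous
  rw [injective_iff_map_eq_zero]
  intro z hz
  obtain ⟨b, s, rfl⟩ := IsLocalization.exists_mk'_eq 𝔮.primeCompl z
  -- the germ of `b` at `ξ` vanishes
  have hb : X.presheaf.germ V ξ hξV b = 0 := by
    have h1 : X.presheaf.stalkSpecializes h (X.presheaf.germ V x hxV b) =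
        X.presheaf.germ V ξ hξV b :=
      TopCat.Presheaf.germ_stalkSpecializes_apply _ _ _ _
    have h2 := IsLocalization.mk'_spec (X.presheaf.stalk x) b s
    have h3 := congrArg (X.presheaf.stalkSpecializes h) h2
    rw [map_mul, hz, zero_mul] at h3
    rw [← h1]
    exact h3.symm
  -- hence some `t ∉ 𝔯` kills `b`
  obtain ⟨⟨t, ht⟩, htb⟩ :=
    (IsLocalization.map_eq_zero_iff 𝔯.primeCompl (X.presheaf.stalk ξ) b).mp hb
  -- the germ of `t` at `x` is non-zero
  have ht0 : X.presheaf.germ V x hxV t ≠ 0 := by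
    intro ht0
    obtain ⟨⟨u, hu⟩, hut⟩ :=
      (IsLocalization.map_eq_zero_iff 𝔮.primeCompl (X.presheaf.stalk x) t).mp ht0
    have hmem : u * t ∈ 𝔯 := by
      change (u * t : Γ(X, V)) = 0 at hut
      rw [hut]; exact 𝔯.zero_mem
    rcases (hV.primeIdealOf ⟨ξ, hξV⟩).isPrime.mem_or_mem hmem with hu' | ht'
    · exact hu (hle hu')
    · exact ht ht'
  have hgb : X.presheaf.germ V x hxV b = 0 := by
    have : X.presheaf.germ V x hxV t * X.presheaf.germ V x hxV b = 0 := by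
      rw [← map_mul]
      change X.presheaf.germ V x hxV ((t * b : Γ(X, V))) = 0
      change (t * b : Γ(X, V)) = 0 at htb
      rw [htb, map_zero]
    exact (mul_eq_zero.mp this).resolve_left ht0
  rw [IsLocalization.mk'_eq_mul_mk'_one]
  change X.presheaf.germ V x hxV b * _ = 0
  rw [hgb, zero_mul]

/-! ## Resolution of `Spec A` uniformizes every valuation ring over `A` -/

section Main

variable {A : Type u} [CommRing A] [IsDomain A] {K : Type u} [Field K] [Algebra A K]
  [IsFractionRing A K]

/-- **Resolution implies local uniformization** (folklore; Zariski 1940, and the way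
Cossart–Piltant 2019 read (LU) off Thm. 1.1): if `Spec A` (`A` a domain with fraction field `K`)
admits a proper birational `π : X → Spec A` with `X` regular, then for every valuation ring `O`
of `K` containing `A` there is a finitely generated `A`-subalgebra `T ⊆ O` of `K` whose
localisation at the centre `𝔪_O ∩ T` is a regular local ring. Proof: the valuative criterion of
properness lifts `Spec O → Spec A` to `l : Spec O → X`; the centre `x = l(𝔪_O)` has a regular,
hence integral, local ring `𝒪_{X,x}`, which embeds into `O` (birationality: the generic point of
`Spec O` goes to the generic point of `X` over `Spec A`, where the stalk is `K`); an affine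
neighbourhood `Spec B ∋ x` is of finite type over `A` and `T :=` the image of `B` in `K` has
`T_{𝔪_O ∩ T} ≅ 𝒪_{X,x}`. [folklore] -/
theorem exists_fg_regular_of_hasResolution (O : ValuationSubring K)
    (hAO : ∀ a : A, algebraMap A K a ∈ O)
    (hres : Scheme.HasResolution (Spec (.of A))) :
    ∃ (T : Subalgebra A K) (h : T.toSubring ≤ O.toSubring), T.FG ∧
      IsRegularLocalRing (Localization.AtPrime
        (Ideal.comap (Subring.inclusion h) (IsLocalRing.maximalIdeal O))) := by
  classical
  obtain ⟨X, π, hπ⟩ := hres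
  haveI := hπ.isProper
  obtain ⟨U, hUd, -, hUiso⟩ := hπ.isBirational
  haveI : IsDomain (CommRingCat.of A) := ‹IsDomain A›
  -- the ring maps `A → O → K`
  let φ₀ : A →+* O := (algebraMap A K).codRestrict O.toSubring hAO
  let ιOK : CommRingCat.of O ⟶ CommRingCat.of K := CommRingCat.ofHom (algebraMap O K)
  let i₂ : Spec (.of O) ⟶ Spec (.of A) := Spec.map (CommRingCat.ofHom φ₀)
  let g : Spec (.of K) ⟶ Spec (.of A) := Spec.map (CommRingCat.ofHom (algebraMap A K))
  have hg : Spec.map ιOK ≫ i₂ = g := by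
    rw [← Spec.map_comp]
    rfl
  -- the generic point of `Spec A` lies in `U`
  let q : Spec (.of K) := closedPoint K
  have hgq : g q = (⊥ : PrimeSpectrum A) := by
    change PrimeSpectrum.comap (algebraMap A K) (closedPoint K) = ⊥
    ext1
    rw [PrimeSpectrum.comap_asIdeal]
    change Ideal.comap (algebraMap A K) (maximalIdeal K) = ⊥
    rw [maximalIdeal_eq_bot, ← RingHom.ker_eq_comap_bot, RingHom.ker_eq_bot_iff_eq_zero]
    intro a ha
    exact (IsFractionRing.injective A K) (by rw [ha, map_zero])
  have hbotU : ((⊥ : PrimeSpectrum A) : Spec (.of A)) ∈ U := by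
    haveI : Nonempty (Spec (.of A)) := ⟨(⊥ : PrimeSpectrum A)⟩
    obtain ⟨y, hy⟩ := hUd.nonempty
    exact ((PrimeSpectrum.le_iff_specializes _ y).mp bot_le).mem_open U.isOpen hy
  have hrange : Set.range g.base ⊆ Set.range U.ι.base := by
    rw [Scheme.Opens.range_ι]
    rintro _ ⟨p, rfl⟩
    obtain rfl : p = q := Subsingleton.elim _ _
    rw [hgq]; exact hbotU
  let g₁ : Spec (.of K) ⟶ U := IsOpenImmersion.lift U.ι g hrange
  have hg₁ : g₁ ≫ U.ι = g := IsOpenImmersion.lift_fac _ _ _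
  haveI := hUiso
  let j : ↑(π ⁻¹ᵁ U) ⟶ X := (π ⁻¹ᵁ U).ι
  let i₁ : Spec (.of K) ⟶ X := g₁ ≫ inv (π ∣_ U) ≫ j
  have hsq : i₁ ≫ π = Spec.map ιOK ≫ i₂ := by
    rw [hg]
    simp only [i₁, j, Category.assoc, ← morphismRestrict_ι, IsIso.inv_hom_id_assoc, hg₁]
  -- valuative criterion of properness
  have hex : ValuativeCriterion.Existence π := by
    have h := (inferInstance : UniversallyClosed π)
    rw [UniversallyClosed.eq_valuativeCriterion] at h
    exact h.1
  obtain ⟨l, hl₁, hl₂⟩ :=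
    (hex { R := O, K := K, i₁ := i₁, i₂ := i₂, commSq := ⟨hsq⟩ }).exists_lift
  -- the centre `x' = l(𝔪_O)` and its regular (hence integral) local ring
  set c : Spec (.of O) := closedPoint O with hc
  haveI hregx : IsRegularLocalRing (X.presheaf.stalk (l c)) := hπ.isRegular (l c)
  haveI : IsDomain (X.presheaf.stalk (l c)) := Matsumura1987_14_3_holds _ hregx
  let ψ := Scheme.stalkClosedPointTo l
  -- `ψ : 𝒪_{X,x'} → O` is injective
  have hψ : Function.Injective ψ := by
    let γ₀ : Spec (.of O) := Spec.map ιOK q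
    have hγc : γ₀ ⤳ c := IsLocalRing.specializes_closedPoint γ₀
    -- (E1) at the generic point
    have hE1 : Function.Injective (l.stalkMap γ₀) := by
      have h1 : Function.Injective (g.stalkMap q) := by
        have hF : IsField ((Spec (.of A)).presheaf.stalk (g q)) := by
          refine isField_stalk_of_eq ?_ (Field.toIsField (Spec (.of A)).functionField)
          rw [genericPoint_eq_bot_of_affine, hgq]
        letI := hF.toField
        exact RingHom.injective _
      have h2 : Function.Injective (g₁.stalkMap q) := by
        rw [← stalkMap_injective_congr hg₁, Scheme.Hom.stalkMap_comp] at h1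
        exact Function.Injective.of_comp_right h1
          (ConcreteCategory.bijective_of_isIso (U.ι.stalkMap (g₁ q))).2
      have h3 : Function.Injective (i₁.stalkMap q) := by
        change Function.Injective ((g₁ ≫ inv (π ∣_ U) ≫ j).stalkMap q)
        rw [Scheme.Hom.stalkMap_comp]
        exact h2.comp (ConcreteCategory.bijective_of_isIso ((inv (π ∣_ U) ≫ j).stalkMap _)).1
      rw [← stalkMap_injective_congr hl₁, Scheme.Hom.stalkMap_comp] at h3
      have h4 : Function.Injective ((Spec.map ιOK).stalkMap q ∘ l.stalkMap γ₀) := h3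
      exact Function.Injective.of_comp h4
    -- (E2) generisation on `X` at the domain `𝒪_{X,x'}`
    have hE2 := stalkSpecializes_injective_of_isDomain (l.base.hom.map_specializes hγc)
    have hE := Scheme.Hom.stalkSpecializes_stalkMap l γ₀ c hγc
    have hcomp : Function.Injective
        (l.stalkMap c ≫ (Spec (.of O)).presheaf.stalkSpecializes hγc) := by
      rw [← hE, CategoryTheory.hom_comp]
      exact hE1.comp hE2
    rw [CategoryTheory.hom_comp] at hcomp
    have hl : Function.Injective (l.stalkMap c) := Function.Injective.of_comp hcomp
    change Function.Injective (l.stalkMap c ≫ (stalkClosedPointIso (.of O)).hom)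
    rw [CategoryTheory.hom_comp]
    exact (ConcreteCategory.bijective_of_isIso (stalkClosedPointIso (.of O)).hom).1.comp hl
  -- an affine neighbourhood `V ∋ x'`, of finite type over `A`
  obtain ⟨_, ⟨V, hV : IsAffineOpen V, rfl⟩, hxV, -⟩ :=
    X.isBasis_affineOpens.exists_subset_of_mem_open (Set.mem_univ (l c)) isOpen_univ
  have hft : (π.appLE ⊤ V le_top).hom.FiniteType :=
    HasRingHomProperty.appLE (P := @LocallyOfFiniteType) π inferInstance ⟨⊤, isAffineOpen_top _⟩
      ⟨V, hV⟩ le_top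
  let α : A →+* Γ(X, V) := (π.appLE ⊤ V le_top).hom.comp (Scheme.ΓSpecIso (.of A)).inv.hom
  have hα : α.FiniteType :=
    hft.comp (RingHom.FiniteType.of_surjective _
      (Scheme.ΓSpecIso (.of A)).symm.commRingCatIsoToRingEquiv.surjective)
  let β : Γ(X, V) →+* O := ψ.hom.comp (X.presheaf.germ V (l c) hxV).hom
  -- compatibility `β ∘ α = (A → O)`
  have key1 : π.appLE ⊤ V le_top ≫ X.presheaf.germ V (l c) hxV =
      (Spec (.of A)).presheaf.germ ⊤ (π (l c)) trivial ≫ π.stalkMap (l c) := by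
    rw [Scheme.Hom.germ_stalkMap, Scheme.Hom.appLE, Category.assoc, TopCat.Presheaf.germ_res]
  have key2 : (Spec (.of A)).presheaf.germ ⊤ ((l ≫ π) c) trivial ≫
      Scheme.stalkClosedPointTo (l ≫ π) = (Scheme.ΓSpecIso (.of A)).hom ≫ CommRingCat.ofHom φ₀ := by
    rw [germ_stalkClosedPointTo_congr hl₂ ⊤ trivial]
    exact Scheme.germ_stalkClosedPointTo_Spec (CommRingCat.ofHom φ₀)
  have key3 : (Spec (.of A)).presheaf.germ ⊤ (π (l c)) trivial ≫ π.stalkMap (l c) ≫ ψ =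
      (Scheme.ΓSpecIso (.of A)).hom ≫ CommRingCat.ofHom φ₀ := by
    rw [← key2, Scheme.stalkClosedPointTo_comp]
    rfl
  have key : (Scheme.ΓSpecIso (.of A)).inv ≫ π.appLE ⊤ V le_top ≫
      X.presheaf.germ V (l c) hxV ≫ ψ = CommRingCat.ofHom φ₀ := by
    rw [← Category.assoc (π.appLE ⊤ V le_top), key1, Category.assoc, key3, Iso.inv_hom_id_assoc]
  have hβα : ∀ a, β (α a) = φ₀ a := fun a => by
    have := ConcreteCategory.congr_hom key a
    simp only [CategoryTheory.comp_apply, CommRingCat.hom_ofHom] at this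
    exact this
  -- the prime of `Γ(X, V)` at `x'` is the preimage of `𝔪_O`
  letI algx := X.presheaf.algebra_section_stalk (⟨l c, hxV⟩ : V)
  have hlocx := hV.isLocalization_stalk ⟨l c, hxV⟩
  set 𝔮 := (hV.primeIdealOf ⟨l c, hxV⟩).asIdeal with h𝔮def
  have h𝔮 : 𝔮 = Ideal.comap β (maximalIdeal O) := by
    rw [h𝔮def, IsAffineOpen.primeIdealOf_eq_map_closedPoint, Spec.map_apply,
      PrimeSpectrum.comap_asIdeal]
    change Ideal.comap (X.presheaf.germ V (l c) hxV).hom (maximalIdeal _) =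
      Ideal.comap (ψ.hom.comp (X.presheaf.germ V (l c) hxV).hom) (maximalIdeal O)
    rw [← Ideal.comap_comap, IsLocalRing.maximalIdeal_comap ψ.hom]
  -- the uniformizing algebra `T = image of Γ(X, V)` in `K`
  letI : Algebra A Γ(X, V) := α.toAlgebra
  haveI : Algebra.FiniteType A Γ(X, V) := hα
  let γ : Γ(X, V) →ₐ[A] K :=
    { (algebraMap O K).comp β with
      commutes' := fun a => by
        change algebraMap O K (β (α a)) = algebraMap A K a
        rw [hβα]; rfl }
  let T : Subalgebra A K := γ.range
  have hTfg : T.FG := by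
    change (γ.range).FG
    rw [← Algebra.map_top]; exact Subalgebra.FG.map _ Algebra.FiniteType.out
  have hTO : T.toSubring ≤ O.toSubring := by
    rintro _ ⟨b, rfl⟩; exact (β b).2
  refine ⟨T, hTO, hTfg, ?_⟩
  set P := Ideal.comap (Subring.inclusion hTO) (maximalIdeal O) with hP
  let γ' : Γ(X, V) →+* T := γ.rangeRestrict.toRingHom
  have hγ' : ∀ b, ((γ' b : T) : K) = (β b : K) := fun b => rfl
  have hγ'sur : Function.Surjective γ' := AlgHom.rangeRestrict_surjective γ
  have hPq : Ideal.comap γ' P = 𝔮 := by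
    ext b
    rw [h𝔮]
    change Subring.inclusion hTO (γ' b) ∈ maximalIdeal O ↔ β b ∈ maximalIdeal O
    rw [show Subring.inclusion hTO (γ' b) = β b from Subtype.ext rfl]
  have hMle : 𝔮.primeCompl ≤ P.primeCompl.comap γ' := fun b hb hb' => hb (by
    rw [← hPq]; exact hb')
  let δ : X.presheaf.stalk (l c) →+* Localization.AtPrime P :=
    IsLocalization.map (Localization.AtPrime P) γ' hMle
  have hδsurj : Function.Surjective δ := by
    intro z
    obtain ⟨t, u, rfl⟩ := IsLocalization.exists_mk'_eq P.primeCompl z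
    obtain ⟨b, rfl⟩ := hγ'sur t
    obtain ⟨s, hs⟩ := hγ'sur u
    have hsq : s ∉ 𝔮 := by
      intro hs𝔮
      rw [← hPq, Ideal.mem_comap, hs] at hs𝔮
      exact u.2 hs𝔮
    refine ⟨IsLocalization.mk' _ b (⟨s, hsq⟩ : 𝔮.primeCompl), ?_⟩
    rw [IsLocalization.map_mk']
    congr 1
    exact Subtype.ext hs
  have hδinj : Function.Injective δ := by
    rw [injective_iff_map_eq_zero]
    intro z hz
    obtain ⟨b, s, rfl⟩ := IsLocalization.exists_mk'_eq 𝔮.primeCompl z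
    rw [IsLocalization.map_mk', IsLocalization.mk'_eq_zero_iff] at hz
    obtain ⟨⟨m, hm⟩, hmb⟩ := hz
    have hm0 : m ≠ 0 := fun h => hm (by rw [h]; exact P.zero_mem)
    have hb0 : γ' b = 0 := (mul_eq_zero.mp hmb).resolve_left hm0
    have hβb : β b = 0 := by
      have h1 : ((γ' b : T) : K) = 0 := by rw [hb0]; rfl
      rw [hγ'] at h1
      exact_mod_cast h1
    have hgerm : X.presheaf.germ V (l c) hxV b = 0 :=
      hψ (by rw [map_zero]; exact hβb)
    rw [IsLocalization.mk'_eq_mul_mk'_one]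
    change X.presheaf.germ V (l c) hxV b * _ = 0
    rw [hgerm, zero_mul]
  exact IsRegularLocalRing.of_ringEquiv (RingEquiv.ofBijective δ ⟨hδinj, hδsurj⟩)

end Main

/-! ## Affine models over a field: consequences for `LocalUniformization3`, `RelLocalUniformization`,
`LocalUniformizationInChar` -/

section OverField

/-- Transport of regularity at the centre along an equality of underlying subrings. [folklore] -/
theorem isRegularLocalRing_centre_of_toSubring_eq {k K : Type u} [Field k] [Field K] [Algebra k K]
    (O : ValuationSubring K) (A' : Subalgebra k K) (h' : A'.toSubring ≤ O.toSubring)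
    {S : Subring K} (hS : S ≤ O.toSubring) (e : A'.toSubring = S)
    (H : IsRegularLocalRing (Localization.AtPrime
      (Ideal.comap (Subring.inclusion hS) (IsLocalRing.maximalIdeal O)))) :
    IsRegularLocalRing (Localization.AtPrime (centreIdeal A' O h')) := by
  subst e; exact H

/-- If `Spec A` has a resolution, an affine model `A ⊆ O` of `K/k` is dominated by a finitely
generated affine model `A ⊆ A' ⊆ O` regular at the centre of `O` (the relative local
uniformization step, from `exists_fg_regular_of_hasResolution`). [folklore] -/
theorem exists_affineModel_regular_of_hasResolution {k K : Type u} [Field k] [Field K]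
    [Algebra k K] (O : ValuationSubring K) (A : Subalgebra k K)
    (hAO : A.toSubring ≤ O.toSubring) (hfg : A.FG) (hfr : IsFractionRing A K)
    (hres : Scheme.HasResolution (Spec (.of A))) :
    ∃ (A' : Subalgebra k K) (h : A'.toSubring ≤ O.toSubring), A ≤ A' ∧ A'.FG ∧
      IsRegularLocalRing (Localization.AtPrime (centreIdeal A' O h)) := by
  classical
  haveI := hfr
  obtain ⟨T, hTO, hTfg, hreg⟩ :=
    exists_fg_regular_of_hasResolution (A := A) (K := K) O (fun a => hAO a.2) hres
  obtain ⟨s₀, rfl⟩ := hfg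
  obtain ⟨t, ht⟩ := hTfg
  have e : (Algebra.adjoin k ((s₀ : Set K) ∪ (t : Set K))).toSubring = T.toSubring := by
    rw [Algebra.adjoin_union_eq_adjoin_adjoin, ← ht]
    rfl
  have h' : (Algebra.adjoin k ((s₀ : Set K) ∪ (t : Set K))).toSubring ≤ O.toSubring := by
    rw [e]; exact hTO
  refine ⟨_, h', Algebra.adjoin_mono Set.subset_union_left, ⟨s₀ ∪ t, by push_cast; rfl⟩,
    isRegularLocalRing_centre_of_toSubring_eq O _ h' hTO e hreg⟩

/-- Under weak resolution over `k` up to dimension `d`, `Spec R` has a resolution for every reduced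
finitely generated `k`-algebra `R` of Krull dimension `≤ d`. [folklore] -/
theorem ResolutionOverUpToDim.hasResolution_spec {k : Type u} [Field k] {d : ℕ}
    (h : ResolutionOverUpToDim k d) (R : Type u) [CommRing R] [_root_.IsReduced R] [Algebra k R]
    [Algebra.FiniteType k R] (hdim : ringKrullDim R ≤ d) :
    Scheme.HasResolution (Spec (.of R)) := by
  let f : Spec (.of R) ⟶ Spec (.of k) := Spec.map (CommRingCat.ofHom (algebraMap k R))
  haveI : LocallyOfFiniteType f :=
    (HasRingHomProperty.Spec_iff (P := @LocallyOfFiniteType)).mpr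
      (RingHom.finiteType_algebraMap.mpr ‹_›)
  refine h (Spec (.of R)) f inferInstance inferInstance inferInstance inferInstance ?_
  have := PrimeSpectrum.topologicalKrullDim_eq_ringKrullDim (R := R)
  exact (le_of_eq this).trans hdim

/-- Under resolution in characteristic `p` over fields in universe `u`, `Spec R` has a resolution
for every reduced finitely generated algebra `R` over a field `k` of characteristic `p`.
[folklore] -/
theorem ResolutionInChar.hasResolution_spec {p : ℕ} (h : ResolutionInChar.{u} p) {k : Type u}
    [Field k] [CharP k p] (R : Type u) [CommRing R] [_root_.IsReduced R] [Algebra k R]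
    [Algebra.FiniteType k R] : Scheme.HasResolution (Spec (.of R)) := by
  let f : Spec (.of R) ⟶ Spec (.of k) := Spec.map (CommRingCat.ofHom (algebraMap k R))
  haveI : LocallyOfFiniteType f :=
    (HasRingHomProperty.Spec_iff (P := @LocallyOfFiniteType)).mpr
      (RingHom.finiteType_algebraMap.mpr ‹_›)
  exact h k (Spec (.of R)) f inferInstance inferInstance inferInstance inferInstance

/-- **Resolution up to dimension `d` over `k` implies relative local uniformization of affine
models of dimension `≤ d` over `k`** (the shape of `LocalUniformization3` for `d = 3`).
[folklore] -/
theorem ResolutionOverUpToDim.localUniformization {k : Type u} [Field k] {d : ℕ}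
    (h : ResolutionOverUpToDim k d) (K : Type u) [Field K] [Algebra k K] (O : ValuationSubring K)
    (A : Subalgebra k K) (hAO : A.toSubring ≤ O.toSubring) (hfg : A.FG) (hfr : IsFractionRing A K)
    (hdim : ringKrullDim A ≤ d) :
    ∃ (A' : Subalgebra k K) (h : A'.toSubring ≤ O.toSubring), A ≤ A' ∧ A'.FG ∧
      IsRegularLocalRing (Localization.AtPrime (centreIdeal A' O h)) :=
  haveI : Algebra.FiniteType k A := A.fg_iff_finiteType.mp hfg
  exists_affineModel_regular_of_hasResolution O A hAO hfg hfr (h.hasResolution_spec A hdim)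

/-- **`CossartPiltant2019LU3` is a corollary of `CossartPiltant2019`** (Cossart–Piltant 2019,
Thm. 1.1 ⇒ (LU) of §4.1 for threefolds over fields, by the valuative criterion of properness;
this makes the docstring claim of `CossartPiltant2019LU3` formal).
[cite: CossartPiltant2019, Thm. 1.1 with §4.1 (LU)] -/
theorem CossartPiltant2019.lu3 (h : CossartPiltant2019.{u}) : CossartPiltant2019LU3.{u} :=
  fun k _ K _ _ O A hAO hfg hfr hdim =>
    (cossartPiltant2019_iff.mp h k).localUniformization K O A hAO hfg hfr hdim

/-- `CossartPiltant2019` implies the patching leaf outright (the conclusion of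
`CossartPiltant2019Patching` is weak resolution in dimension `≤ 3` over `k`). [folklore] -/
theorem CossartPiltant2019.patching (h : CossartPiltant2019.{u}) : CossartPiltant2019Patching.{u} :=
  fun k _ _ _ => cossartPiltant2019_iff.mp h k

/-- `CossartPiltant2019` implies the descent leaf outright (the conclusion of
`CossartPiltant2019LU3OfComplete` is `CossartPiltant2019LU3`, `CossartPiltant2019.lu3`).
[folklore] -/
theorem CossartPiltant2019.lu3OfComplete (h : CossartPiltant2019.{u}) :
    CossartPiltant2019LU3OfComplete.{u} :=
  fun _ => h.lu3

/-- **The first decomposition layer is lossless**: `CossartPiltant2019` is equivalent to the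
conjunction of surface resolution over fields, local uniformization in dimension three and the
patching implication (`cossartPiltant2019_of_patching` and the corollaries above). [folklore] -/
theorem cossartPiltant2019_iff_leaves :
    CossartPiltant2019.{u} ↔
      CossartJannsenSaito2020.{u} ∧ CossartPiltant2019LU3.{u} ∧ CossartPiltant2019Patching.{u} :=
  ⟨fun h => ⟨h.cossartJannsenSaito2020, h.lu3, h.patching⟩,
    fun ⟨hCJS, hLU, hP⟩ => cossartPiltant2019_of_patching hCJS hLU hP⟩

/-- **Resolution in characteristic `p` implies relative local uniformization**
(`RelLocalUniformization`, Novacoski–Spivakovsky's Def. 2.20 form) of every valuation ring of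
every function field over a field of characteristic `p` (folklore: Zariski 1940 read backwards;
Novacoski–Spivakovsky 2014, §1). [folklore] -/
theorem ResolutionInChar.relLocalUniformization {p : ℕ} (h : ResolutionInChar.{0} p)
    (k K : Type) [Field k] [CharP k p] [Field K] [Algebra k K] (O : ValuationSubring K) :
    RelLocalUniformization k K O := by
  intro R hfg hfr hRO
  haveI : Algebra.FiniteType k R := R.fg_iff_finiteType.mp hfg
  exact exists_affineModel_regular_of_hasResolution O R hRO hfg hfr (h.hasResolution_spec (k := k) R)

/-- **Resolution in characteristic `p` implies Zariski local uniformization in characteristic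
`p`** (`LocalUniformizationInChar`; for `p = 0` this recovers Zariski's 1940 theorem from
Hironaka's, `Hironaka1964.localUniformizationInChar`). [folklore] -/
theorem ResolutionInChar.localUniformizationInChar {p : ℕ} (h : ResolutionInChar.{u} p) :
    LocalUniformizationInChar.{u} p := by
  intro k K _ _ _ _ hKfg O hO
  obtain ⟨A, hAO, hfg, hfr⟩ := exists_affineModel k K hKfg O hO
  haveI : Algebra.FiniteType k A := A.fg_iff_finiteType.mp hfg
  obtain ⟨A', h', hle, hfg', hreg⟩ :=
    exists_affineModel_regular_of_hasResolution O A hAO hfg hfr (h.hasResolution_spec (k := k) A)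
  exact ⟨A', h', hfg', isFractionRing_of_le hle hfr, hreg⟩

/-- **Zariski's local uniformization theorem (1940) from Hironaka's theorem**: in characteristic
zero every valuation ring of a function field over `k` is locally uniformizable. [folklore] -/
theorem Hironaka1964.localUniformizationInChar (h : Hironaka1964.{u}) :
    LocalUniformizationInChar.{u} 0 :=
  ResolutionInChar.localUniformizationInChar h

/-- **Resolution in characteristic `p` implies relative local uniformization, in the form of
route item `LurelOfResolution`** (`Summits/ResolutionOfSingularities/…/Theses/Valuative.lean`,
stmt-0739): the prescribed finitely generated `R ⊆ O` need not be a model of `K`; it is first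
enlarged by an affine model of `O` (`exists_affineModel`). [folklore] -/
theorem lurel_of_resolutionInChar :
    ∀ p : ℕ, p.Prime → ResolutionInChar.{0} p →
      ∀ (k K : Type) [Field k] [CharP k p] [Field K] [Algebra k K],
        (⊤ : IntermediateField k K).FG → ∀ O : ValuationSubring K,
          (∀ c : k, algebraMap k K c ∈ O) → ∀ R : Subalgebra k K, R.FG →
            R.toSubring ≤ O.toSubring →
              ∃ (A : Subalgebra k K) (h : A.toSubring ≤ O.toSubring), R ≤ A ∧ A.FG ∧
                IsFractionRing A K ∧ IsRegularLocalRing (Localization.AtPrime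
                  (Ideal.comap (Subring.inclusion h) (IsLocalRing.maximalIdeal O))) := by
  intro p _ h k K _ _ _ _ hKfg O hO R hRfg hRO
  obtain ⟨A₀, hA₀O, hA₀fg, hA₀fr⟩ := exists_affineModel k K hKfg O hO
  have hR'O : (R ⊔ A₀).toSubring ≤ O.toSubring := by
    let Oalg : Subalgebra k K := { O.toSubring with algebraMap_mem' := hO }
    change R ⊔ A₀ ≤ Oalg
    exact sup_le (fun x hx => hRO hx) (fun x hx => hA₀O hx)
  have hR'fr : IsFractionRing ↥(R ⊔ A₀) K := isFractionRing_of_le le_sup_right hA₀fr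
  obtain ⟨A, hA, hle, hAfg, hreg⟩ :=
    h.relLocalUniformization k K O (R ⊔ A₀) (hRfg.sup hA₀fg) hR'fr hR'O
  exact ⟨A, hA, le_sup_left.trans hle, hAfg, isFractionRing_of_le hle hR'fr, hreg⟩

end OverField

end Literature.AlgebraicGeometry.Resolution

end
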